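import Mathlib
import HarnessLib
import Summits.Ventures.LatticeQCDFlow.Exactness.CabibboMarinariORSweepFiguresOfMerit
import Summits.Ventures.LatticeQCDFlow.Exactness.SU2HeatBathORSweep
import Summits.Ventures.LatticeQCDFlow.Scoring.DoeblinSkeleton

/-!
# The exact link heat-bath sweep followed by over-relaxation sweeps (the engine's `SU(2)` path `'hb' + n_or × 'or'`: Creutz / Kennedy–Pendleton + OR): its one-step Doeblin certificate, every event a finite `τ_int`, a certified burn-in, the CLT and asymptotically exact batch-means error bars from EVERY start

HONEST FRAMING: exact (Metropolis-corrected) sampling algorithms for lattice gauge theory; figures of merit are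
autocorrelation/cost numbers at stated couplings and volumes; no continuum-physics claim.

Venture `LatticeQCDFlow` (cell pub-lqcd), topic `Exactness`, FANOUT row 9 (eng-latcore, GEN-23; the engine
`latflow.core.updates.composite_sweep(f, β, 'hb', n_or)` for `SU(2)`: the single-link heat bath IS the exact
conditional redraw — typed from the uniforms up in `SU2HeatBathFromUniforms.lean` — followed by `n_or`
over-relaxation sweeps).  NEW WORK of the cell over the tree, nothing cited as a fact, no number claimed: gen-9's
`HeatBathSweepErgodic.lean` / `WilsonHeatBathErgodic.lean` (`siteHeatBath`, `heatBathSweep_minorised` — ONE-STEP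
`(m/M)^{|l|} · Haar^{⊗E} ≤ K(ω, ·)`, `heatBathSweep_invariant_piGibbsLaw`, `isMarkovKernel_heatBathSweep`,
`wilsonMeasure_eq_piGibbsLaw`), gen-17/21's `CabibboMarinariORSweep.lean` / `SUNMetropolisORSweepErgodic.lean`
(`cmORSweep`, `cmORSweep_invariant_gibbsProbability`), `SU2HeatBathORSweep.lean` (convergence of this composite,
Doeblin constant inside the proof), GEN-23's `CabibboMarinariORSweepFiguresOfMerit.lean` (`minorised_exactStep_of_target`,
`smul_piGibbsLaw_le_pi`), rows 13 / 8 (`…_of_nHit` consequences).  Printed counterparts NAMED ONLY: Creutz 1980,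
Kennedy–Pendleton 1985; Creutz 1987 / Brown–Woch 1987; Meyn–Tweedie 1993; Flegal–Jones 2010; Madras–Sokal 1988.

## Content (torus `(ℤ/L)^d`, `L ≥ 2`, `G = SU(N)` in the defining representation `suRep N` — for `N = 2` the
## engine's path; any real `β`; a heat-bath scan `l` through every link; ANY OR schedule `sched`;
## `K = cmORSweep sched ∘ₖ cycle (l.map (siteHeatBath Haar^{⊗} (gibbsDensity (β S_W))))`, `π = wilsonMeasure (suRep N) β`)

* **`wilson_heatBath_orSweep_certificate`** — `K` leaves `π` invariant and `ε' • π ≤ K(U, ·) = K^1(U, ·)` for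
  EVERY `U`, `0 < ε' ≤ 1`.
* **`wilson_heatBath_orSweep_tauInt_setACF_le`** (ONE `B ≥ 0`: `τ_int(1_A) ≤ 1/2 + B/(1 − π(A))` for EVERY
  event), **`wilson_heatBath_orSweep_timeAverage_bias_le`** (burn-in `B/n` from EVERY start),
  **`wilson_heatBath_orSweep_timeAverage_clt`**, **`wilson_heatBath_orSweep_batchMeans_tendstoInMeasure`**,
  **`wilson_heatBath_orSweep_batchMeans_coverage`** (`σ²_f > 0`), **`wilson_heatBath_orSweep_tauInt_tendstoInMeasure`**
  (`Var_π f ≠ 0`) — every bounded measurable `f`, EVERY initial law; **`wilson_heatBath_orSweep_tauInt_autocov_le`** —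
  `τ_int` of EVERY bounded observable `≤ T = 1/ε' − 1/2` (generic: `centred_bounded`, `tauInt_autocov_le_of_target_certificate`,
  over row 8's `Scoring.tauInt_le_of_doeblin_nHit`).

NOT CLAIMED: any value of `ε', B, T`; the capped loops as coded (`SU2HeatBathCapped.lean` + `KernelTVPerturbation.lean`
quantify that perturbation of the exact heat bath); floating point and the engine's `k ≤ 10⁻¹²` OR skip; `L = 1`.
-/

noncomputable section

namespace Summit.Ventures.LatticeQCDFlow.Exactness

open MeasureTheory Measure Set Filter Topology Function ProbabilityTheory ProbabilityTheory.Kernel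
open Literature.MathematicalPhysics.QuantumFieldTheory
open Summit.Ventures.LatticeQCDFlow.Scoring (replicaSEsq tauInt autocov kop)
open scoped ENNReal

/-! ## §0 Centring a bounded observable -/

section Centre

variable {Ω : Type*} [MeasurableSpace Ω]

/-- Centring a bounded measurable observable at its mean: measurable, bounded by `2C`, mean zero. -/
theorem centred_bounded {π : Measure Ω} [IsProbabilityMeasure π] {f : Ω → ℝ} (hf : Measurable f) {C : ℝ}
    (hC : ∀ x, |f x| ≤ C) :
    Measurable (fun y => f y - ∫ z, f z ∂π) ∧ (∀ y, |f y - ∫ z, f z ∂π| ≤ 2 * C) ∧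
      ∫ y, (f y - ∫ z, f z ∂π) ∂π = 0 := by
  have hint : Integrable f π := Scoring.integrable_of_bounded π hf hC
  have hmean : |∫ z, f z ∂π| ≤ C := by
    rw [← Real.norm_eq_abs]
    calc ‖∫ z, f z ∂π‖ ≤ C * π.real univ :=
          norm_integral_le_of_norm_le_const (Eventually.of_forall fun z => by rw [Real.norm_eq_abs]; exact hC z)
      _ = C := by rw [probReal_univ, mul_one]
  refine ⟨hf.sub measurable_const, fun y => ?_, ?_⟩
  · calc |f y - ∫ z, f z ∂π| ≤ |f y| + |∫ z, f z ∂π| := abs_sub _ _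
      _ ≤ C + C := add_le_add (hC y) hmean
      _ = 2 * C := by ring
  · rw [integral_sub hint (integrable_const _), MeasureTheory.integral_const, probReal_univ, one_smul, sub_self]

/-- From a certificate by the target (`ε' • π ≤ K^m(U, ·)`, `m > 0`, `0 < ε'`): ONE bound `T = m/ε' − 1/2 ≥ 0` on the
integrated autocorrelation time of EVERY bounded measurable observable. -/
theorem tauInt_autocov_le_of_target_certificate {K : Kernel Ω Ω} [IsMarkovKernel K] {π : Measure Ω}
    [IsProbabilityMeasure π] (hinv : Invariant K π) {m : ℕ} {ε' : ℝ≥0∞} (hm : 0 < m) (hε0 : 0 < ε') (hε1 : ε' ≤ 1)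
    (hmin : ∀ U, ε' • π ≤ nHit K m U) :
    ∃ T : ℝ, 0 ≤ T ∧ ∀ (f : Ω → ℝ), Measurable f → ∀ C : ℝ, (∀ x, |f x| ≤ C) →
      Scoring.tauInt (fun t => Scoring.autocov K π (fun y => f y - ∫ z, f z ∂π) t
        / Scoring.autocov K π (fun y => f y - ∫ z, f z ∂π) 0) ≤ T := by
  have he0 : 0 < ε'.toReal := ENNReal.toReal_pos hε0.ne' (ne_top_of_le_ne_top ENNReal.one_ne_top hε1)
  have he1 : ε'.toReal ≤ 1 := ENNReal.toReal_le_of_le_ofReal zero_le_one (by simpa using hε1)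
  have hm1 : (1 : ℝ) ≤ m := by exact_mod_cast hm
  refine ⟨(m : ℝ) / ε'.toReal - 1 / 2, ?_, fun f hf C hC => ?_⟩
  · have : (1 : ℝ) ≤ (m : ℝ) / ε'.toReal := by rw [le_div_iff₀ he0]; nlinarith
    linarith
  · obtain ⟨hfm, hfb, hf0⟩ := centred_bounded (π := π) hf hC
    exact Scoring.tauInt_le_of_doeblin_nHit hinv (GeneralNCMC.minorised_setwise hmin) hm hε0 hfm hfb hf0

end Centre

section HBOR

variable (N : ℕ) {d L : ℕ} {m : Type*} [Fintype m] [DecidableEq m]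

/-- **THE ONE-STEP DOEBLIN CERTIFICATE OF THE EXACT LINK HEAT-BATH SWEEP FOLLOWED BY ANY OR SCHEDULE** (`L ≥ 2`,
any `β`, a scan `l` through every link): the composite leaves `wilsonMeasure (suRep N) β` invariant and dominates
`ε' · wilsonMeasure (suRep N) β` from EVERY configuration in ONE step, `0 < ε' ≤ 1`. -/
theorem wilson_heatBath_orSweep_certificate [NeZero L] (hL : 2 ≤ L) (β : ℝ) {l : List (Edge d L)} (hl : ∀ e, e ∈ l)
    (sched : List (Edge d L × (Fin N ≃ Fin 2 ⊕ m))) :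
    Invariant (cmORSweep sched ∘ₖ
                cycle (l.map (siteHeatBath
                  (fun _ : Edge d L => haarProbability (Matrix.specialUnitaryGroup (Fin N) ℂ))
                  (gibbsDensity fun U : GaugeConfig d L (Matrix.specialUnitaryGroup (Fin N) ℂ) => β * wilsonAction (suRep N) U))))
        (wilsonMeasure (d := d) (L := L) (suRep N) β) ∧
      ∃ ε' : ℝ≥0∞, 0 < ε' ∧ ε' ≤ 1 ∧ ∀ U : GaugeConfig d L (Matrix.specialUnitaryGroup (Fin N) ℂ),
        ε' • wilsonMeasure (d := d) (L := L) (suRep N) β ≤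
          nHit (cmORSweep sched ∘ₖ
                cycle (l.map (siteHeatBath
                  (fun _ : Edge d L => haarProbability (Matrix.specialUnitaryGroup (Fin N) ℂ))
                  (gibbsDensity fun U : GaugeConfig d L (Matrix.specialUnitaryGroup (Fin N) ℂ) => β * wilsonAction (suRep N) U)))) 1 U := by
  obtain ⟨mlo, Mhi, hm0, hMtop, hp, hmp, hpM⟩ :=
    Scoring.wilson_gibbsDensity_pinched (d := d) (L := L) (suRep N) continuous_suRep β
  haveI := isMarkovKernel_heatBathSweep
    (μ := fun _ : Edge d L => haarProbability (Matrix.specialUnitaryGroup (Fin N) ℂ)) hp hm0 hMtop hmp hpM l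
  haveI : IsProbabilityMeasure (wilsonMeasure (d := d) (L := L) (suRep N) β) := isProbabilityMeasure_wilsonMeasure _ continuous_suRep β
  -- exactness of both factors for the Wilson measure
  have hHB : Invariant (cycle (l.map (siteHeatBath
                  (fun _ : Edge d L => haarProbability (Matrix.specialUnitaryGroup (Fin N) ℂ))
                  (gibbsDensity fun U : GaugeConfig d L (Matrix.specialUnitaryGroup (Fin N) ℂ) => β * wilsonAction (suRep N) U)))) (wilsonMeasure (d := d) (L := L) (suRep N) β) := by
    rw [wilsonMeasure_eq_piGibbsLaw]
    exact heatBathSweep_invariant_piGibbsLaw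
      (μ := fun _ : Edge d L => haarProbability (Matrix.specialUnitaryGroup (Fin N) ℂ)) hp hm0 hMtop hmp hpM l
  have hOR : Invariant (cmORSweep (d := d) (L := L) sched) (wilsonMeasure (d := d) (L := L) (suRep N) β) := by
    rw [← gibbsProbability_eq_wilsonMeasure]
    exact cmORSweep_invariant_gibbsProbability N hL β sched
  -- the heat-bath sweep dominates `(m/M)^|l| ·` product Haar, which dominates a multiple of the Wilson measure
  have hmin := heatBathSweep_minorised
    (μ := fun _ : Edge d L => haarProbability (Matrix.specialUnitaryGroup (Fin N) ℂ)) hp hm0 hMtop hmp hpM hl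
  set Z : ℝ≥0∞ := ∫⁻ ω, gibbsDensity (fun U : GaugeConfig d L (Matrix.specialUnitaryGroup (Fin N) ℂ) => β * wilsonAction (suRep N) U) ω
    ∂Measure.pi (fun _ : Edge d L => haarProbability (Matrix.specialUnitaryGroup (Fin N) ℂ)) with hZ
  have hZlo : mlo ≤ Z := by
    calc mlo = ∫⁻ _, mlo ∂Measure.pi (fun _ : Edge d L => haarProbability (Matrix.specialUnitaryGroup (Fin N) ℂ)) := by
          rw [MeasureTheory.lintegral_const, measure_univ, mul_one]
      _ ≤ Z := lintegral_mono fun ω => hmp ω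
  have hZhi : Z ≤ Mhi := by
    calc Z ≤ ∫⁻ _, Mhi ∂Measure.pi (fun _ : Edge d L => haarProbability (Matrix.specialUnitaryGroup (Fin N) ℂ)) :=
          lintegral_mono fun ω => hpM ω
      _ = Mhi := by rw [MeasureTheory.lintegral_const, measure_univ, mul_one]
  have hZ0 : Z ≠ 0 := (lt_of_lt_of_le (pos_iff_ne_zero.2 hm0) hZlo).ne'
  have hZtop : Z ≠ ∞ := ne_top_of_le_ne_top hMtop hZhi
  have hM0 : Mhi ≠ 0 := (lt_of_lt_of_le (pos_iff_ne_zero.2 hm0) ((hmp 1).trans (hpM 1))).ne'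
  have hcmp : (Z * Mhi⁻¹) • (wilsonMeasure (d := d) (L := L) (suRep N) β) ≤
      Measure.pi (fun _ : Edge d L => haarProbability (Matrix.specialUnitaryGroup (Fin N) ℂ)) := by
    rw [wilsonMeasure_eq_piGibbsLaw]
    exact smul_piGibbsLaw_le_pi hM0 hMtop hpM hZ0 hZtop
  have hminW : ∀ U : GaugeConfig d L (Matrix.specialUnitaryGroup (Fin N) ℂ), ((mlo * Mhi⁻¹) ^ l.length * (Z * Mhi⁻¹)) • (wilsonMeasure (d := d) (L := L) (suRep N) β) ≤ cycle (l.map (siteHeatBath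
                  (fun _ : Edge d L => haarProbability (Matrix.specialUnitaryGroup (Fin N) ℂ))
                  (gibbsDensity fun U : GaugeConfig d L (Matrix.specialUnitaryGroup (Fin N) ℂ) => β * wilsonAction (suRep N) U))) U := fun U => by
    rw [← smul_smul]
    refine le_trans ?_ (hmin U)
    refine Measure.le_iff'.2 fun A => ?_
    simp only [Measure.smul_apply, smul_eq_mul]
    exact mul_le_mul' le_rfl (Measure.le_iff'.1 hcmp A)
  have hcomp := minorised_exactStep_of_target hminW (cmORSweep sched) hOR
  have hε'0 : (mlo * Mhi⁻¹) ^ l.length * (Z * Mhi⁻¹) ≠ 0 :=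
    mul_ne_zero (pow_ne_zero _ (mul_ne_zero hm0 (ENNReal.inv_ne_zero.2 hMtop)))
      (mul_ne_zero hZ0 (ENNReal.inv_ne_zero.2 hMtop))
  have hε'1 : (mlo * Mhi⁻¹) ^ l.length * (Z * Mhi⁻¹) ≤ 1 := by
    have h1 := Measure.le_iff'.1 (hcomp 1) univ
    rwa [Measure.smul_apply, smul_eq_mul, measure_univ, measure_univ, mul_one] at h1
  refine ⟨hOR.comp hHB, _, pos_iff_ne_zero.2 hε'0, hε'1, fun U => ?_⟩
  rw [GeneralNCMC.nHit_one]
  exact hcomp U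

/-! ## Figures of merit: `τ_int` of every event, burn-in, CLT, batch means, coverage, `τ̂_int` -/

/-- **EVERY EVENT HAS A FINITE `τ_int` UNDER THE HEAT-BATH + OR COMPOSITE — ONE CONSTANT FOR ALL EVENTS**: `B ≥ 0`
with `τ_int(1_A) ≤ 1/2 + B/(1 − π(A))` (scorers' `Scoring.tauInt`) for EVERY measurable `A` with `0 < π(A) < 1`. -/
theorem wilson_heatBath_orSweep_tauInt_setACF_le [NeZero L] (hL : 2 ≤ L) (β : ℝ) {l : List (Edge d L)} (hl : ∀ e, e ∈ l)
    (sched : List (Edge d L × (Fin N ≃ Fin 2 ⊕ m))) :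
    ∃ B : ℝ, 0 ≤ B ∧ ∀ A : Set (GaugeConfig d L (Matrix.specialUnitaryGroup (Fin N) ℂ)), MeasurableSet A →
      0 < (wilsonMeasure (d := d) (L := L) (suRep N) β).real A → (wilsonMeasure (d := d) (L := L) (suRep N) β).real A < 1 →
      tauInt (setACF (cmORSweep sched ∘ₖ
                cycle (l.map (siteHeatBath
                  (fun _ : Edge d L => haarProbability (Matrix.specialUnitaryGroup (Fin N) ℂ))
                  (gibbsDensity fun U : GaugeConfig d L (Matrix.specialUnitaryGroup (Fin N) ℂ) => β * wilsonAction (suRep N) U))))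
          (wilsonMeasure (d := d) (L := L) (suRep N) β) A) ≤
        1 / 2 + B / (1 - (wilsonMeasure (d := d) (L := L) (suRep N) β).real A) := by
  haveI : IsProbabilityMeasure (wilsonMeasure (d := d) (L := L) (suRep N) β) := isProbabilityMeasure_wilsonMeasure _ continuous_suRep β
  obtain ⟨mlo, Mhi, hm0, hMtop, hp, hmp, hpM⟩ :=
    Scoring.wilson_gibbsDensity_pinched (d := d) (L := L) (suRep N) continuous_suRep β
  haveI := isMarkovKernel_heatBathSweep
    (μ := fun _ : Edge d L => haarProbability (Matrix.specialUnitaryGroup (Fin N) ℂ)) hp hm0 hMtop hmp hpM l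
  obtain ⟨hinv, ε', hε0, hε1, hmin⟩ := wilson_heatBath_orSweep_certificate N (d := d) hL β hl sched
  have he0 : 0 < ε'.toReal := ENNReal.toReal_pos hε0.ne' (ne_top_of_le_ne_top ENNReal.one_ne_top hε1)
  have he1 : ε'.toReal ≤ 1 := ENNReal.toReal_le_of_le_ofReal zero_le_one (by simpa using hε1)
  refine ⟨1 / ε'.toReal - 1, ?_, fun A hA h0 h1 => ?_⟩
  · rw [sub_nonneg, le_div_iff₀ he0]; nlinarith
  · simpa using GeneralNCMC.tauInt_setACF_le_of_nHit (GeneralNCMC.minorised_setwise hmin) hε0 hε1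
      Nat.one_pos hinv hA h0 h1

/-- **CERTIFIED BURN-IN OF THE HEAT-BATH + OR COMPOSITE FROM EVERY START**: one `B ≥ 0` with
`|E_{μ₀}[(1/n) Σ_{t<n} g(U_t)] − ∫ g dπ| ≤ B/n` for EVERY initial law, every `[0,1]`-valued measurable `g`, `n ≥ 1`. -/
theorem wilson_heatBath_orSweep_timeAverage_bias_le [NeZero L] (hL : 2 ≤ L) (β : ℝ) {l : List (Edge d L)} (hl : ∀ e, e ∈ l)
    (sched : List (Edge d L × (Fin N ≃ Fin 2 ⊕ m)))
    [IsMarkovKernel (cycle (l.map (siteHeatBath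
                  (fun _ : Edge d L => haarProbability (Matrix.specialUnitaryGroup (Fin N) ℂ))
                  (gibbsDensity fun U : GaugeConfig d L (Matrix.specialUnitaryGroup (Fin N) ℂ) => β * wilsonAction (suRep N) U))))] :
    ∃ B : ℝ, 0 ≤ B ∧ ∀ (μ₀ : Measure (GaugeConfig d L (Matrix.specialUnitaryGroup (Fin N) ℂ))) [IsProbabilityMeasure μ₀]
      (g : GaugeConfig d L (Matrix.specialUnitaryGroup (Fin N) ℂ) → ℝ), Measurable g → (∀ U, 0 ≤ g U) → (∀ U, g U ≤ 1) →
      ∀ n : ℕ, n ≠ 0 →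
      |∫ x, (∑ t ∈ Finset.range n, g (x t)) / n
          ∂(Kernel.trajMeasure (X := fun _ : ℕ => GaugeConfig d L (Matrix.specialUnitaryGroup (Fin N) ℂ)) μ₀
              (fun t : ℕ => (cmORSweep sched ∘ₖ
                cycle (l.map (siteHeatBath
                  (fun _ : Edge d L => haarProbability (Matrix.specialUnitaryGroup (Fin N) ℂ))
                  (gibbsDensity fun U : GaugeConfig d L (Matrix.specialUnitaryGroup (Fin N) ℂ) => β * wilsonAction (suRep N) U)))).comap
                (fun h : (i : ↥(Finset.Iic t)) → GaugeConfig d L (Matrix.specialUnitaryGroup (Fin N) ℂ) =>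
                  h ⟨t, Finset.mem_Iic.2 le_rfl⟩) (measurable_pi_apply _)))
        - ∫ U, g U ∂(wilsonMeasure (d := d) (L := L) (suRep N) β)| ≤ B / n := by
  haveI : IsProbabilityMeasure (wilsonMeasure (d := d) (L := L) (suRep N) β) := isProbabilityMeasure_wilsonMeasure _ continuous_suRep β
  obtain ⟨hinv, ε', hε0, hε1, hmin⟩ := wilson_heatBath_orSweep_certificate N (d := d) hL β hl sched
  have he0 : 0 < ε'.toReal := ENNReal.toReal_pos hε0.ne' (ne_top_of_le_ne_top ENNReal.one_ne_top hε1)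
  refine ⟨1 / ε'.toReal, by positivity, fun μ₀ _ g hg h0 h1 n hn0 => ?_⟩
  calc _ ≤ ((1 : ℕ) : ℝ) / (ε'.toReal * n) :=
        GeneralNCMC.chain_timeAverage_bias_le_of_nHit (GeneralNCMC.minorised_setwise hmin) hε0 hε1 Nat.one_pos
          hinv μ₀ hg h0 h1 hn0
    _ = 1 / ε'.toReal / n := by rw [Nat.cast_one, div_div]

/-- **THE CLT FOR TIME AVERAGES OF THE HEAT-BATH + OR COMPOSITE, FROM EVERY INITIAL LAW** (`|f| ≤ C` measurable,
`Y ~ N(0, σ²_f)`): `(√n)⁻¹ Σ_{t<n} (f(U_t) − π f) ⇒ Y` under `P_{μ₀}`. -/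
theorem wilson_heatBath_orSweep_timeAverage_clt [NeZero L] (hL : 2 ≤ L) (β : ℝ) {l : List (Edge d L)} (hl : ∀ e, e ∈ l)
    (sched : List (Edge d L × (Fin N ≃ Fin 2 ⊕ m)))
    [IsMarkovKernel (cycle (l.map (siteHeatBath
                  (fun _ : Edge d L => haarProbability (Matrix.specialUnitaryGroup (Fin N) ℂ))
                  (gibbsDensity fun U : GaugeConfig d L (Matrix.specialUnitaryGroup (Fin N) ℂ) => β * wilsonAction (suRep N) U))))]
    {f : GaugeConfig d L (Matrix.specialUnitaryGroup (Fin N) ℂ) → ℝ} (hf : Measurable f) {C : ℝ} (hC : ∀ U, |f U| ≤ C)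
    (μ₀ : Measure (GaugeConfig d L (Matrix.specialUnitaryGroup (Fin N) ℂ))) [IsProbabilityMeasure μ₀]
    [IsProbabilityMeasure (Kernel.trajMeasure (X := fun _ : ℕ => GaugeConfig d L (Matrix.specialUnitaryGroup (Fin N) ℂ)) μ₀
              (fun t : ℕ => (cmORSweep sched ∘ₖ
                cycle (l.map (siteHeatBath
                  (fun _ : Edge d L => haarProbability (Matrix.specialUnitaryGroup (Fin N) ℂ))
                  (gibbsDensity fun U : GaugeConfig d L (Matrix.specialUnitaryGroup (Fin N) ℂ) => β * wilsonAction (suRep N) U)))).comap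
                (fun h : (i : ↥(Finset.Iic t)) → GaugeConfig d L (Matrix.specialUnitaryGroup (Fin N) ℂ) =>
                  h ⟨t, Finset.mem_Iic.2 le_rfl⟩) (measurable_pi_apply _)))]
    {Ω' : Type*} [MeasurableSpace Ω'] {P' : Measure Ω'} [IsProbabilityMeasure P'] {Y : Ω' → ℝ}
    (hY : HasLaw Y (gaussianReal 0 (Real.toNNReal
      ((∫ y, (f y - ∫ z, f z ∂(wilsonMeasure (d := d) (L := L) (suRep N) β)) ^ 2 ∂(wilsonMeasure (d := d) (L := L) (suRep N) β))
              + 2 * ∑' k, ∫ y, (f y - ∫ z, f z ∂(wilsonMeasure (d := d) (L := L) (suRep N) β))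
                * (kop (cmORSweep sched ∘ₖ
                cycle (l.map (siteHeatBath
                  (fun _ : Edge d L => haarProbability (Matrix.specialUnitaryGroup (Fin N) ℂ))
                  (gibbsDensity fun U : GaugeConfig d L (Matrix.specialUnitaryGroup (Fin N) ℂ) => β * wilsonAction (suRep N) U)))))^[k + 1]
                  (fun y => f y - ∫ z, f z ∂(wilsonMeasure (d := d) (L := L) (suRep N) β)) y ∂(wilsonMeasure (d := d) (L := L) (suRep N) β)))) P') :
    TendstoInDistribution (fun (n : ℕ) (x : ℕ → GaugeConfig d L (Matrix.specialUnitaryGroup (Fin N) ℂ)) =>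
        (Real.sqrt n)⁻¹ * ∑ t ∈ Finset.range n, (f (x t) - ∫ z, f z ∂(wilsonMeasure (d := d) (L := L) (suRep N) β)))
      atTop Y (fun _ => (Kernel.trajMeasure (X := fun _ : ℕ => GaugeConfig d L (Matrix.specialUnitaryGroup (Fin N) ℂ)) μ₀
              (fun t : ℕ => (cmORSweep sched ∘ₖ
                cycle (l.map (siteHeatBath
                  (fun _ : Edge d L => haarProbability (Matrix.specialUnitaryGroup (Fin N) ℂ))
                  (gibbsDensity fun U : GaugeConfig d L (Matrix.specialUnitaryGroup (Fin N) ℂ) => β * wilsonAction (suRep N) U)))).comap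
                (fun h : (i : ↥(Finset.Iic t)) → GaugeConfig d L (Matrix.specialUnitaryGroup (Fin N) ℂ) =>
                  h ⟨t, Finset.mem_Iic.2 le_rfl⟩) (measurable_pi_apply _)))) P' := by
  haveI : IsProbabilityMeasure (wilsonMeasure (d := d) (L := L) (suRep N) β) := isProbabilityMeasure_wilsonMeasure _ continuous_suRep β
  obtain ⟨hinv, ε', hε0, -, hmin⟩ := wilson_heatBath_orSweep_certificate N (d := d) hL β hl sched
  exact GeneralNCMC.tendstoInDistribution_timeAverage_of_nHit hinv hε0.ne' hmin Nat.one_pos hf hC μ₀ hY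

/-- **BATCH MEANS ESTIMATE `σ²_f` CONSISTENTLY ALONG THE HEAT-BATH + OR COMPOSITE, FROM EVERY INITIAL LAW**:
`a b · SE²_BM → σ²_f` in probability as `a, b → ∞`. -/
theorem wilson_heatBath_orSweep_batchMeans_tendstoInMeasure [NeZero L] (hL : 2 ≤ L) (β : ℝ) {l : List (Edge d L)} (hl : ∀ e, e ∈ l)
    (sched : List (Edge d L × (Fin N ≃ Fin 2 ⊕ m)))
    [IsMarkovKernel (cycle (l.map (siteHeatBath
                  (fun _ : Edge d L => haarProbability (Matrix.specialUnitaryGroup (Fin N) ℂ))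
                  (gibbsDensity fun U : GaugeConfig d L (Matrix.specialUnitaryGroup (Fin N) ℂ) => β * wilsonAction (suRep N) U))))]
    {f : GaugeConfig d L (Matrix.specialUnitaryGroup (Fin N) ℂ) → ℝ} (hf : Measurable f) {C : ℝ} (hC : ∀ U, |f U| ≤ C)
    (μ₀ : Measure (GaugeConfig d L (Matrix.specialUnitaryGroup (Fin N) ℂ))) [IsProbabilityMeasure μ₀]
    {a b' : ℕ → ℕ} (ha : Tendsto a atTop atTop) (hb' : Tendsto b' atTop atTop) :
    TendstoInMeasure (Kernel.trajMeasure (X := fun _ : ℕ => GaugeConfig d L (Matrix.specialUnitaryGroup (Fin N) ℂ)) μ₀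
              (fun t : ℕ => (cmORSweep sched ∘ₖ
                cycle (l.map (siteHeatBath
                  (fun _ : Edge d L => haarProbability (Matrix.specialUnitaryGroup (Fin N) ℂ))
                  (gibbsDensity fun U : GaugeConfig d L (Matrix.specialUnitaryGroup (Fin N) ℂ) => β * wilsonAction (suRep N) U)))).comap
                (fun h : (i : ↥(Finset.Iic t)) → GaugeConfig d L (Matrix.specialUnitaryGroup (Fin N) ℂ) =>
                  h ⟨t, Finset.mem_Iic.2 le_rfl⟩) (measurable_pi_apply _)))
      (fun (n : ℕ) (x : ℕ → GaugeConfig d L (Matrix.specialUnitaryGroup (Fin N) ℂ)) => ((b' n * a n : ℕ) : ℝ)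
        * replicaSEsq (fun j (x : ℕ → GaugeConfig d L (Matrix.specialUnitaryGroup (Fin N) ℂ)) =>
            (∑ i ∈ Finset.range (b' n), f (x (b' n * j + i))) / (b' n)) (a n) x)
      atTop (fun _ => (∫ y, (f y - ∫ z, f z ∂(wilsonMeasure (d := d) (L := L) (suRep N) β)) ^ 2 ∂(wilsonMeasure (d := d) (L := L) (suRep N) β))
              + 2 * ∑' k, ∫ y, (f y - ∫ z, f z ∂(wilsonMeasure (d := d) (L := L) (suRep N) β))
                * (kop (cmORSweep sched ∘ₖ
                cycle (l.map (siteHeatBath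
                  (fun _ : Edge d L => haarProbability (Matrix.specialUnitaryGroup (Fin N) ℂ))
                  (gibbsDensity fun U : GaugeConfig d L (Matrix.specialUnitaryGroup (Fin N) ℂ) => β * wilsonAction (suRep N) U)))))^[k + 1]
                  (fun y => f y - ∫ z, f z ∂(wilsonMeasure (d := d) (L := L) (suRep N) β)) y ∂(wilsonMeasure (d := d) (L := L) (suRep N) β)) := by
  haveI : IsProbabilityMeasure (wilsonMeasure (d := d) (L := L) (suRep N) β) := isProbabilityMeasure_wilsonMeasure _ continuous_suRep β
  obtain ⟨hinv, ε', hε0, hε1, hmin⟩ := wilson_heatBath_orSweep_certificate N (d := d) hL β hl sched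
  exact Scoring.chain_batchMeans_sigmaHat_tendstoInMeasure_of_nHit hinv (GeneralNCMC.minorised_setwise hmin)
    hε0 hε1 Nat.one_pos hf hC μ₀ ha hb'

/-- **THE BATCH-MEANS INTERVAL OF A HEAT-BATH + OR RUN IS ASYMPTOTICALLY EXACT** (`σ²_f > 0`, `a, b → ∞`, any
initial law, `z > 0`): `P_{μ₀}(|√(ab) (f̄_{ab} − π f)| ≤ z σ̂_BM) → (gaussianReal 0 1)[−z, z]`. -/
theorem wilson_heatBath_orSweep_batchMeans_coverage [NeZero L] (hL : 2 ≤ L) (β : ℝ) {l : List (Edge d L)} (hl : ∀ e, e ∈ l)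
    (sched : List (Edge d L × (Fin N ≃ Fin 2 ⊕ m)))
    [IsMarkovKernel (cycle (l.map (siteHeatBath
                  (fun _ : Edge d L => haarProbability (Matrix.specialUnitaryGroup (Fin N) ℂ))
                  (gibbsDensity fun U : GaugeConfig d L (Matrix.specialUnitaryGroup (Fin N) ℂ) => β * wilsonAction (suRep N) U))))]
    {f : GaugeConfig d L (Matrix.specialUnitaryGroup (Fin N) ℂ) → ℝ} (hf : Measurable f) {C : ℝ} (hC : ∀ U, |f U| ≤ C)
    (hσ : 0 < (∫ y, (f y - ∫ z, f z ∂(wilsonMeasure (d := d) (L := L) (suRep N) β)) ^ 2 ∂(wilsonMeasure (d := d) (L := L) (suRep N) β))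
              + 2 * ∑' k, ∫ y, (f y - ∫ z, f z ∂(wilsonMeasure (d := d) (L := L) (suRep N) β))
                * (kop (cmORSweep sched ∘ₖ
                cycle (l.map (siteHeatBath
                  (fun _ : Edge d L => haarProbability (Matrix.specialUnitaryGroup (Fin N) ℂ))
                  (gibbsDensity fun U : GaugeConfig d L (Matrix.specialUnitaryGroup (Fin N) ℂ) => β * wilsonAction (suRep N) U)))))^[k + 1]
                  (fun y => f y - ∫ z, f z ∂(wilsonMeasure (d := d) (L := L) (suRep N) β)) y ∂(wilsonMeasure (d := d) (L := L) (suRep N) β))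
    (μ₀ : Measure (GaugeConfig d L (Matrix.specialUnitaryGroup (Fin N) ℂ))) [IsProbabilityMeasure μ₀]
    {a b' : ℕ → ℕ} (ha : Tendsto a atTop atTop) (hb' : Tendsto b' atTop atTop) {z : ℝ} (hz : 0 < z) :
    Tendsto (fun n : ℕ => (Kernel.trajMeasure (X := fun _ : ℕ => GaugeConfig d L (Matrix.specialUnitaryGroup (Fin N) ℂ)) μ₀
              (fun t : ℕ => (cmORSweep sched ∘ₖ
                cycle (l.map (siteHeatBath
                  (fun _ : Edge d L => haarProbability (Matrix.specialUnitaryGroup (Fin N) ℂ))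
                  (gibbsDensity fun U : GaugeConfig d L (Matrix.specialUnitaryGroup (Fin N) ℂ) => β * wilsonAction (suRep N) U)))).comap
                (fun h : (i : ↥(Finset.Iic t)) → GaugeConfig d L (Matrix.specialUnitaryGroup (Fin N) ℂ) =>
                  h ⟨t, Finset.mem_Iic.2 le_rfl⟩) (measurable_pi_apply _))).real
      {x | |((Real.sqrt ((b' n * a n : ℕ) : ℝ))⁻¹
          * ∑ t ∈ Finset.range (b' n * a n), (f (x t) - ∫ z, f z ∂(wilsonMeasure (d := d) (L := L) (suRep N) β)))
        / Real.sqrt (((b' n * a n : ℕ) : ℝ)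
          * replicaSEsq (fun j (x : ℕ → GaugeConfig d L (Matrix.specialUnitaryGroup (Fin N) ℂ)) =>
              (∑ i ∈ Finset.range (b' n), f (x (b' n * j + i))) / (b' n)) (a n) x)| ≤ z})
      atTop (𝓝 ((gaussianReal 0 1).real (Set.Icc (-z) z))) := by
  haveI : IsProbabilityMeasure (wilsonMeasure (d := d) (L := L) (suRep N) β) := isProbabilityMeasure_wilsonMeasure _ continuous_suRep β
  obtain ⟨hinv, ε', hε0, hε1, hmin⟩ := wilson_heatBath_orSweep_certificate N (d := d) hL β hl sched
  exact Scoring.doeblinPower_batchMeans_studentized_coverage hinv hmin hε0 hε1 Nat.one_pos hf hC hσ μ₀ ha hb' hz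

/-- **THE REPORTED `τ̂_int = σ̂²_BM/(2 v̂)` OF A HEAT-BATH + OR RUN IS CONSISTENT** (`Var_π f ≠ 0`, `a, b → ∞`, any
initial law): `σ̂²/(2 v̂) → τ_int(ρ_f) = 1/2 + Σ_{t≥1} ρ_f(t)` in probability. -/
theorem wilson_heatBath_orSweep_tauInt_tendstoInMeasure [NeZero L] (hL : 2 ≤ L) (β : ℝ) {l : List (Edge d L)} (hl : ∀ e, e ∈ l)
    (sched : List (Edge d L × (Fin N ≃ Fin 2 ⊕ m)))
    [IsMarkovKernel (cycle (l.map (siteHeatBath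
                  (fun _ : Edge d L => haarProbability (Matrix.specialUnitaryGroup (Fin N) ℂ))
                  (gibbsDensity fun U : GaugeConfig d L (Matrix.specialUnitaryGroup (Fin N) ℂ) => β * wilsonAction (suRep N) U))))]
    {f : GaugeConfig d L (Matrix.specialUnitaryGroup (Fin N) ℂ) → ℝ} (hf : Measurable f) {C : ℝ} (hC : ∀ U, |f U| ≤ C)
    (hvar : autocov (cmORSweep sched ∘ₖ
                cycle (l.map (siteHeatBath
                  (fun _ : Edge d L => haarProbability (Matrix.specialUnitaryGroup (Fin N) ℂ))
                  (gibbsDensity fun U : GaugeConfig d L (Matrix.specialUnitaryGroup (Fin N) ℂ) => β * wilsonAction (suRep N) U))))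
        (wilsonMeasure (d := d) (L := L) (suRep N) β) (fun y => f y - ∫ z, f z ∂(wilsonMeasure (d := d) (L := L) (suRep N) β)) 0 ≠ 0)
    (μ₀ : Measure (GaugeConfig d L (Matrix.specialUnitaryGroup (Fin N) ℂ))) [IsProbabilityMeasure μ₀]
    {a b' : ℕ → ℕ} (ha : Tendsto a atTop atTop) (hb' : Tendsto b' atTop atTop) :
    TendstoInMeasure (Kernel.trajMeasure (X := fun _ : ℕ => GaugeConfig d L (Matrix.specialUnitaryGroup (Fin N) ℂ)) μ₀
              (fun t : ℕ => (cmORSweep sched ∘ₖ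
                cycle (l.map (siteHeatBath
                  (fun _ : Edge d L => haarProbability (Matrix.specialUnitaryGroup (Fin N) ℂ))
                  (gibbsDensity fun U : GaugeConfig d L (Matrix.specialUnitaryGroup (Fin N) ℂ) => β * wilsonAction (suRep N) U)))).comap
                (fun h : (i : ↥(Finset.Iic t)) → GaugeConfig d L (Matrix.specialUnitaryGroup (Fin N) ℂ) =>
                  h ⟨t, Finset.mem_Iic.2 le_rfl⟩) (measurable_pi_apply _)))
      (fun (n : ℕ) (x : ℕ → GaugeConfig d L (Matrix.specialUnitaryGroup (Fin N) ℂ)) =>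
        (((b' n * a n : ℕ) : ℝ)
          * replicaSEsq (fun j (x : ℕ → GaugeConfig d L (Matrix.specialUnitaryGroup (Fin N) ℂ)) =>
              (∑ i ∈ Finset.range (b' n), f (x (b' n * j + i))) / (b' n)) (a n) x)
        / (2 * ((∑ t ∈ Finset.range (b' n * a n), f (x t) ^ 2) / ((b' n * a n : ℕ) : ℝ)
            - ((∑ t ∈ Finset.range (b' n * a n), f (x t)) / ((b' n * a n : ℕ) : ℝ)) ^ 2)))
      atTop (fun _ => tauInt (fun t =>
        autocov (cmORSweep sched ∘ₖ
                cycle (l.map (siteHeatBath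
                  (fun _ : Edge d L => haarProbability (Matrix.specialUnitaryGroup (Fin N) ℂ))
                  (gibbsDensity fun U : GaugeConfig d L (Matrix.specialUnitaryGroup (Fin N) ℂ) => β * wilsonAction (suRep N) U))))
            (wilsonMeasure (d := d) (L := L) (suRep N) β) (fun y => f y - ∫ z, f z ∂(wilsonMeasure (d := d) (L := L) (suRep N) β)) t
          / autocov (cmORSweep sched ∘ₖ
                cycle (l.map (siteHeatBath
                  (fun _ : Edge d L => haarProbability (Matrix.specialUnitaryGroup (Fin N) ℂ))
                  (gibbsDensity fun U : GaugeConfig d L (Matrix.specialUnitaryGroup (Fin N) ℂ) => β * wilsonAction (suRep N) U))))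
            (wilsonMeasure (d := d) (L := L) (suRep N) β) (fun y => f y - ∫ z, f z ∂(wilsonMeasure (d := d) (L := L) (suRep N) β)) 0)) := by
  haveI : IsProbabilityMeasure (wilsonMeasure (d := d) (L := L) (suRep N) β) := isProbabilityMeasure_wilsonMeasure _ continuous_suRep β
  obtain ⟨hinv, ε', hε0, hε1, hmin⟩ := wilson_heatBath_orSweep_certificate N (d := d) hL β hl sched
  exact Scoring.chain_batchMeans_tauInt_tendstoInMeasure_of_nHit hinv hmin hε0 hε1 Nat.one_pos hf hC hvar μ₀ ha hb'

/-- **`τ_int` OF EVERY BOUNDED OBSERVABLE UNDER THE HEAT-BATH + OR COMPOSITE — ONE CONSTANT `T = 1/ε' − 1/2`**: for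
every bounded measurable `f` (plaquette, Polyakov loop, …) the scorers' `τ_int` of `γ_f(t)/γ_f(0)` is `≤ T` (row 8's
`Scoring.tauInt_le_of_doeblin_nHit` on the one-step certificate by the target). -/
theorem wilson_heatBath_orSweep_tauInt_autocov_le [NeZero L] (hL : 2 ≤ L) (β : ℝ) {l : List (Edge d L)} (hl : ∀ e, e ∈ l)
    (sched : List (Edge d L × (Fin N ≃ Fin 2 ⊕ m)))
    [IsMarkovKernel (cycle (l.map (siteHeatBath
                  (fun _ : Edge d L => haarProbability (Matrix.specialUnitaryGroup (Fin N) ℂ))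
                  (gibbsDensity fun U : GaugeConfig d L (Matrix.specialUnitaryGroup (Fin N) ℂ) => β * wilsonAction (suRep N) U))))] :
    ∃ T : ℝ, 0 ≤ T ∧ ∀ (f : GaugeConfig d L (Matrix.specialUnitaryGroup (Fin N) ℂ) → ℝ), Measurable f → ∀ C : ℝ, (∀ U, |f U| ≤ C) →
      tauInt (fun t =>
            autocov (cmORSweep sched ∘ₖ
                cycle (l.map (siteHeatBath
                  (fun _ : Edge d L => haarProbability (Matrix.specialUnitaryGroup (Fin N) ℂ))
                  (gibbsDensity fun U : GaugeConfig d L (Matrix.specialUnitaryGroup (Fin N) ℂ) => β * wilsonAction (suRep N) U)))) (wilsonMeasure (d := d) (L := L) (suRep N) β)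
                (fun y => f y - ∫ z, f z ∂(wilsonMeasure (d := d) (L := L) (suRep N) β)) t
              / autocov (cmORSweep sched ∘ₖ
                cycle (l.map (siteHeatBath
                  (fun _ : Edge d L => haarProbability (Matrix.specialUnitaryGroup (Fin N) ℂ))
                  (gibbsDensity fun U : GaugeConfig d L (Matrix.specialUnitaryGroup (Fin N) ℂ) => β * wilsonAction (suRep N) U)))) (wilsonMeasure (d := d) (L := L) (suRep N) β)
                (fun y => f y - ∫ z, f z ∂(wilsonMeasure (d := d) (L := L) (suRep N) β)) 0) ≤ T := by
  haveI : IsProbabilityMeasure (wilsonMeasure (d := d) (L := L) (suRep N) β) := isProbabilityMeasure_wilsonMeasure _ continuous_suRep β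
  obtain ⟨hinv, ε', hε0, hε1, hmin⟩ := wilson_heatBath_orSweep_certificate N (d := d) hL β hl sched
  exact tauInt_autocov_le_of_target_certificate hinv Nat.one_pos hε0 hε1 hmin

end HBOR

end Summit.Ventures.LatticeQCDFlow.Exactness

end
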